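import Summits.CriticalPhenomena.Ising3D.Control2DL13BoxMTable
import Mathlib.Tactic.NormNum
import HarnessLib

/-!
# RB-2 certificate `j111516_functional_deriv2d_L13_E032_sig1o8_box0.93-0.935.json` (Λ = 13, E₀ = 32): Δ_ε ∉ [93/100, 187/200] at Δ_σ = 1/8 under A2D′ — (R), the large-`S` half, in the kernel
(cell `pub-ising3x`, seat controls-1 gen 17; KERNEL PATH for the 2D γ-certificates, Λ = 13 — CONTROL-ONLY)

HONEST FRAMING: lottery ticket; floor = tightest certified 3D Ising CFT bounds; no exact-solution
claim without a proof. CONTROL-ONLY (`d = 2`, `Δ_σ = 1/8`, the 2D Ising control; axiom set `A2D′`).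

(R) `region_boxM` for the table `wtboxM` (`Control2DL13BoxMTable`): the compactified region polynomial `QhatboxM`
(`S₁ = 64`, `d = 13`) is non-negative on `τ ∈ [0,1]`, `v ∈ [0,1]` by the tensor-Bernstein SHAPE tree `cregboxM`
(9 leaves; every Bernstein coefficient computed and decided in the kernel, `Control2DPolyCertAuto2`, in 1 chunks of
≤ 12 leaves re-assembled along the splits), and `S ≤ S₁` by the per-`J` shapes `cregJboxM` of the Table file;
`region_of_kernelCertAuto` turns the two kernel facts into hypothesis `hR` verbatim. No facts, standard axioms only.
-/

namespace Summit.CriticalPhenomena.Ising3D.Control2D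

open Literature.MathematicalPhysics.QuantumFieldTheory.ConformalBootstrap3D

set_option maxHeartbeats 0 in
set_option maxRecDepth 200000 in
/-- Chunk 0 of the large-`S` tree (box `q₁=1, a₁=0; q₂=1, a₂=0`; 9 leaves), decided in the kernel. [folklore] -/
theorem cregboxM_n0 :
    checkAuto₂ QhatboxM 14 1 0 1 1 0 1
    (Shape₂.splitO (Shape₂.splitI (Shape₂.leaf) (Shape₂.splitO (Shape₂.leaf) (Shape₂.splitI (Shape₂.leaf) (Shape₂.leaf)))) (Shape₂.splitI (Shape₂.leaf) (Shape₂.splitO (Shape₂.splitI (Shape₂.leaf) (Shape₂.leaf)) (Shape₂.splitI (Shape₂.leaf) (Shape₂.leaf))))) = true := by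
  decide +kernel

/-- Tensor-Bernstein tree SHAPE for the compactified region polynomial on `[0,1] × [0,1]` (`S₁ = 64`; 9 leaves). [folklore] -/
def cregboxM : Shape₂ :=
  Shape₂.splitO (Shape₂.splitI (Shape₂.leaf) (Shape₂.splitO (Shape₂.leaf) (Shape₂.splitI (Shape₂.leaf) (Shape₂.leaf)))) (Shape₂.splitI (Shape₂.leaf) (Shape₂.splitO (Shape₂.splitI (Shape₂.leaf) (Shape₂.leaf)) (Shape₂.splitI (Shape₂.leaf) (Shape₂.leaf))))

/-- **Kernel check of the large-`S` certificate** (assembled from the 1 chunks). [folklore] -/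
theorem cregboxM_ok : checkAuto₂ QhatboxM 14 1 0 1 1 0 1 cregboxM = true :=
  cregboxM_n0

/-- **(R) for the table** (hypothesis `hR` of the explicit certificate theorems, `E₀ = 32`, `s = 1/8`): every
inequality re-decided in the kernel. [folklore] -/
theorem region_boxM (b : ℝ) (J : ℕ) (hb : 0 ≤ b) (hE : (32 : ℝ) ≤ 2 * b + J) :
    0 ≤ ∑ p ∈ slL13.toFinset, (wtboxM p : ℝ) * ((1 - (-1 : ℝ) ^ (p.1 + p.2)) * 2 ^ (p.1 + p.2) *
      (qFactor₁ (1 / 8) (b + J) p.1 * qFactor₁ (1 / 8) b p.2 +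
        qFactor₁ (1 / 8) b p.1 * qFactor₁ (1 / 8) (b + J) p.2)) :=
  region_of_kernelCertAuto wtboxM slL13_nodup slL13_deg 13 14 (by norm_num) (by norm_num) PregboxM_eq
    (by decide +kernel) QhatboxM_eq cregboxM cregboxM_ok cregJboxM (by decide) cregJboxM_ok b J hb
    (by exact_mod_cast hE)

end Summit.CriticalPhenomena.Ising3D.Control2D
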